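import Mathlib
import HarnessLib
import Literature.MathematicalPhysics.QuantumLattice.KohnLuttingerChannelStates
import Summits.HubbardSuperconductivity.HubbardSuperconductivity.Theorems.WeakCouplingBCSDefsKlThirdOrder
import Summits.HubbardSuperconductivity.HubbardSuperconductivity.Theorems.ChiralWindowCwKLChiralWindowD4Invariant
import Summits.HubbardSuperconductivity.HubbardSuperconductivity.Theorems.ChiralWindowCwKLChiralWindowGradient
import Summits.HubbardSuperconductivity.HubbardSuperconductivity.Theorems.ChiralWindowCwKLChiralWindowRotPartner

/-!
# Route `WeakCouplingBCS` — channel-margin lane of `WcbcsKohnLuttingerB1g` (stmt-HubbardSuperconductivity-0158):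
# parity identities of the third-order chain kernel — on `E` states the chains CANCEL

The third-order chain kernel of the particle–particle-irreducible Cooper vertex is
`chainKernel3 = χ₀(k - k')² + χ₀(k + k')²` (`Theorems/WeakCouplingBCSDefsKlThirdOrder.lean`; longitudinal bubble
chain + crossed ladder).  The explicit-`U₀` rows use two elementary symmetry facts about its quadratic form on the
Fermi curve of the square-lattice band `ε₀ = squareDispersion 1 0` (cell file U0-TABLE.md v0 §1–§2, v3.1 §2; the
(R-hyp) stratum of REF-CHECK §187, so far hand-checked):

* on ODD gap functions (`ψ(-k) = -ψ(k)`, i.e. exactly the `E` channel, `inChannel_E_iff_odd`) the two chain terms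
  CANCEL: `⟨ψ, chainKernel3 ψ⟩ = 0` — the `E` competitor gains nothing from the third-order chains, which is why
  every row of `WeakCouplingBCSDefsKlU0Record.lean` / `…KlU0WindowRecord.lean` carries `s3(E) = 0`;
* on EVEN gap functions (the one-dimensional channels `A1g, A2g, B1g, B2g`, `even_of_inChannel`) the two chain
  terms have EQUAL forms, `⟨ψ, χ₀(k-k')² ψ⟩ = ⟨ψ, χ₀(k+k')² ψ⟩` (so the chain form is that of `2χ₀(k+k')²`
  whenever the latter is integrable); on odd ones `⟨ψ, χ₀(k-k')² ψ⟩ = -⟨ψ, χ₀(k+k')² ψ⟩`.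

Both follow from the inversion invariance `k ↦ -k` of the Fermi-curve measure `σ_μ` (`-id = rot²`, the tree's
`CwKLChiralWindow.Negative.rot_rot`, and `kl_d4_rot_measurePreserving` with the gradient formula `stub_klGradient`,
`μ < 0`) by the change of variables `k' ↦ -k'` in the inner integral — no integrability is needed (the statements are about the Bochner forms as
defined).  We prove the kernel identities for an ARBITRARY profile `f` (`f(k ∓ k')` in place of `χ₀(k ∓ k')²`) and
specialise.  Nothing here asserts a pairing instability.

References: Raghu–Kivelson–Scalapino 2010 App. A (diagrams (3a), (3d)); Scalapino–Loh–Hirsch 1986 (the chains).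
-/

noncomputable section

-- the tree's namespace `Summit.<Summit>.<Problem>.Theorems` repeats the summit name by design (D-0017)
set_option linter.dupNamespace false

namespace Summit.HubbardSuperconductivity.HubbardSuperconductivity.Theorems

open MeasureTheory Literature.MathematicalPhysics.QuantumLattice

namespace KlThirdOrder

/-! ### Inversion symmetry of momentum space and of the Fermi-curve measure -/

-- `rot² = -id` and `rot(-k) = -rot k` are the tree's `CwKLChiralWindow.Negative.rot_rot` and `kl_rp_rot_neg`.

/-- The axis reflection is linear: `refl(-k) = -refl k`. [folklore] -/
theorem reflMomentum_neg (k : Momentum) : reflMomentum (-k) = -reflMomentum k := by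
  ext i; fin_cases i <;> simp

/-- **Inversion invariance of the Fermi-curve measure**: `k ↦ -k` preserves `σ_μ = fermiCurveMeasure ε₀ μ` for
`μ < 0` (`-id = rot²` and `rot` preserves `σ_μ`). [folklore] -/
theorem measurePreserving_neg_fermiCurveMeasure {μ : ℝ} (hμ : μ < 0) :
    MeasurePreserving (fun k : Momentum => -k) (fermiCurveMeasure (squareDispersion 1 0) μ)
      (fermiCurveMeasure (squareDispersion 1 0) μ) := by
  have hrot := kl_d4_rot_measurePreserving stub_klGradient hμ
  have h : (fun k : Momentum => -k) = rotMomentum ∘ rotMomentum :=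
    funext fun k => (CwKLChiralWindow.Negative.rot_rot k).symm
  rw [h]
  exact hrot.comp hrot

/-- Change of variables `k ↦ -k` in a Fermi-curve integral (`μ < 0`; any integrand, no integrability needed).
[folklore] -/
theorem integral_comp_neg_fermiCurveMeasure {μ : ℝ} (hμ : μ < 0) (g : Momentum → ℝ) :
    ∫ k, g (-k) ∂fermiCurveMeasure (squareDispersion 1 0) μ = ∫ k, g k ∂fermiCurveMeasure (squareDispersion 1 0) μ :=
  (measurePreserving_neg_fermiCurveMeasure hμ).integral_comp (Homeomorph.neg Momentum).measurableEmbedding g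

/-! ### Parity of channel states -/

/-- **The one-dimensional channels consist of even gap functions**: if `ψ` transforms in `A1g`, `A2g`, `B1g` or
`B2g` then `ψ(-k) = ψ(k)` (`-id = r² ∈ D₄` has character `+1` in every one-dimensional irrep).  The `E` channel
consists exactly of the odd ones (`inChannel_E_iff_odd`). [folklore] -/
theorem even_of_inChannel {χ : D4Irrep} (hχ : χ ≠ D4Irrep.E) {ψ : Momentum → ℝ} (h : InChannel χ ψ)
    (k : Momentum) : ψ (-k) = ψ k := by
  have h1 := congrFun h k
  have h2 := congrFun h (-k)
  cases χ with
  | E => exact absurd rfl hχ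
  | A1g =>
    simp only [d4Project, sum_dihedralGroup_four, d4Momentum_r_zero, d4Momentum_r_one, d4Momentum_r_two,
      d4Momentum_r_three, d4Momentum_sr_zero, d4Momentum_sr_one, d4Momentum_sr_two, d4Momentum_sr_three,
      D4Irrep.char, D4Irrep.dim, CwKLChiralWindow.Negative.rot_rot, kl_rp_rot_neg, reflMomentum_neg, neg_neg]
      at h1 h2
    norm_num at h1 h2
    linarith
  | A2g =>
    simp only [d4Project, sum_dihedralGroup_four, d4Momentum_r_zero, d4Momentum_r_one, d4Momentum_r_two,
      d4Momentum_r_three, d4Momentum_sr_zero, d4Momentum_sr_one, d4Momentum_sr_two, d4Momentum_sr_three,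
      D4Irrep.char, D4Irrep.dim, CwKLChiralWindow.Negative.rot_rot, kl_rp_rot_neg, reflMomentum_neg, neg_neg]
      at h1 h2
    norm_num at h1 h2
    linarith
  | B1g =>
    simp only [d4Project, sum_dihedralGroup_four, d4Momentum_r_zero, d4Momentum_r_one, d4Momentum_r_two,
      d4Momentum_r_three, d4Momentum_sr_zero, d4Momentum_sr_one, d4Momentum_sr_two, d4Momentum_sr_three,
      D4Irrep.char, D4Irrep.dim, zmod_four_val.1, zmod_four_val.2.1, zmod_four_val.2.2.1,
      zmod_four_val.2.2.2, CwKLChiralWindow.Negative.rot_rot, kl_rp_rot_neg, reflMomentum_neg, neg_neg]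
      at h1 h2
    norm_num at h1 h2
    linarith
  | B2g =>
    simp only [d4Project, sum_dihedralGroup_four, d4Momentum_r_zero, d4Momentum_r_one, d4Momentum_r_two,
      d4Momentum_r_three, d4Momentum_sr_zero, d4Momentum_sr_one, d4Momentum_sr_two, d4Momentum_sr_three,
      D4Irrep.char, D4Irrep.dim, zmod_four_val.1, zmod_four_val.2.1, zmod_four_val.2.2.1,
      zmod_four_val.2.2.2, CwKLChiralWindow.Negative.rot_rot, kl_rp_rot_neg, reflMomentum_neg, neg_neg]
      at h1 h2
    norm_num at h1 h2
    linarith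

/-- Channel states of `A1g, A2g, B1g, B2g` are even; channel states of `E` are odd. [folklore] -/
theorem isChannelState_parity {ε : Momentum → ℝ} {μ : ℝ} {χ : D4Irrep} {ψ : Momentum → ℝ}
    (hψ : IsChannelState ε μ χ ψ) :
    (χ ≠ D4Irrep.E → ∀ k, ψ (-k) = ψ k) ∧ (χ = D4Irrep.E → ∀ k, ψ (-k) = -ψ k) := by
  refine ⟨fun hχ k => even_of_inChannel hχ hψ.2.2 k, fun hχ => ?_⟩
  subst hχ
  exact (inChannel_E_iff_odd ψ).1 hψ.2.2

/-! ### Difference kernels versus sum kernels -/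

/-- **Even states: `⟨ψ, f(k-k') ψ⟩ = ⟨ψ, f(k+k') ψ⟩`** for every profile `f` (change of variables `k' ↦ -k'`, `σ_μ`
inversion-invariant; no integrability needed). [folklore] -/
theorem kform_sub_eq_kform_add_of_even {μ : ℝ} (hμ : μ < 0) (f : Momentum → ℝ) {ψ : Momentum → ℝ}
    (heven : ∀ k, ψ (-k) = ψ k) :
    kform (fermiCurveMeasure (squareDispersion 1 0) μ) (fun k k' => f (k - k')) ψ =
      kform (fermiCurveMeasure (squareDispersion 1 0) μ) (fun k k' => f (k + k')) ψ := by
  unfold kform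
  congr 1
  funext k
  congr 1
  rw [← integral_comp_neg_fermiCurveMeasure hμ (fun k' => f (k - k') * ψ k')]
  congr 1
  funext k'
  simp only [heven, sub_neg_eq_add]

/-- **Odd states: `⟨ψ, f(k-k') ψ⟩ = -⟨ψ, f(k+k') ψ⟩`** for every profile `f`. [folklore] -/
theorem kform_sub_eq_neg_kform_add_of_odd {μ : ℝ} (hμ : μ < 0) (f : Momentum → ℝ) {ψ : Momentum → ℝ}
    (hodd : ∀ k, ψ (-k) = -ψ k) :
    kform (fermiCurveMeasure (squareDispersion 1 0) μ) (fun k k' => f (k - k')) ψ =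
      -kform (fermiCurveMeasure (squareDispersion 1 0) μ) (fun k k' => f (k + k')) ψ := by
  unfold kform
  rw [← integral_neg]
  congr 1
  funext k
  rw [← mul_neg, ← integral_neg]
  congr 1
  rw [← integral_comp_neg_fermiCurveMeasure hμ (fun k' => f (k - k') * ψ k')]
  congr 1
  funext k'
  simp only [hodd, sub_neg_eq_add, mul_neg]

/-! ### The chain kernel -/

/-- **On odd gap functions the third-order chains cancel**: `⟨ψ, (χ₀(k-k')² + χ₀(k+k')²) ψ⟩_{σ_μ} = 0` for
`ψ(-k) = -ψ(k)`, `μ < 0` — the inner integrand is odd under `k' ↦ -k'`. [cite: RaghuKivelsonScalapino2010, App. A (3a)] -/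
theorem kform_chainKernel3_eq_zero_of_odd {μ : ℝ} (hμ : μ < 0) {ψ : Momentum → ℝ}
    (hodd : ∀ k, ψ (-k) = -ψ k) :
    kform (fermiCurveMeasure (squareDispersion 1 0) μ) (chainKernel3 (squareDispersion 1 0) μ) ψ = 0 := by
  unfold kform
  have hinner : ∀ k : Momentum,
      ∫ k', chainKernel3 (squareDispersion 1 0) μ k k' * ψ k' ∂fermiCurveMeasure (squareDispersion 1 0) μ = 0 := by
    intro k
    have h := integral_comp_neg_fermiCurveMeasure hμ
      (fun k' => chainKernel3 (squareDispersion 1 0) μ k k' * ψ k')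
    have hpt : ∀ k' : Momentum, chainKernel3 (squareDispersion 1 0) μ k (-k') * ψ (-k') =
        -(chainKernel3 (squareDispersion 1 0) μ k k' * ψ k') := by
      intro k'
      simp only [chainKernel3, hodd, sub_neg_eq_add, ← sub_eq_add_neg]
      ring
    simp_rw [hpt, integral_neg] at h
    linarith
  simp_rw [hinner, mul_zero, integral_zero]

/-- **The `E` competitor gains nothing from the third-order chains**: for every `E`-channel state `ψ` on the Fermi
curve of `ε₀` (`μ < 0`), `⟨ψ, chainKernel3 ψ⟩ = 0` — the structural reason for `s3(E) = 0` in every explicit-`U₀` row.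
[cite: RaghuKivelsonScalapino2010, App. A (3a)] -/
theorem kform_chainKernel3_eq_zero_of_E {μ : ℝ} (hμ : μ < 0) {ψ : Momentum → ℝ}
    (hψ : IsChannelState (squareDispersion 1 0) μ D4Irrep.E ψ) :
    kform (fermiCurveMeasure (squareDispersion 1 0) μ) (chainKernel3 (squareDispersion 1 0) μ) ψ = 0 :=
  kform_chainKernel3_eq_zero_of_odd hμ ((inChannel_E_iff_odd ψ).1 hψ.2.2)

/-- **Even states: the two chain terms have equal forms**, `⟨ψ, χ₀(k-k')² ψ⟩ = ⟨ψ, χ₀(k+k')² ψ⟩` (so the chain form is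
that of `2χ₀(k+k')²`, the quantity the rows' `c3B` and `s3` bound, whenever the latter form is a convergent integral).
[cite: RaghuKivelsonScalapino2010, App. A (3d)] -/
theorem kform_lindhardSq_sub_eq_add_of_even {μ : ℝ} (hμ : μ < 0) {ψ : Momentum → ℝ}
    (heven : ∀ k, ψ (-k) = ψ k) :
    kform (fermiCurveMeasure (squareDispersion 1 0) μ)
        (fun k k' => lindhardFunction (squareDispersion 1 0) μ (k - k') ^ 2) ψ =
      kform (fermiCurveMeasure (squareDispersion 1 0) μ)
        (fun k k' => lindhardFunction (squareDispersion 1 0) μ (k + k') ^ 2) ψ :=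
  kform_sub_eq_kform_add_of_even hμ (fun q => lindhardFunction (squareDispersion 1 0) μ q ^ 2) heven

/-- The same for the states of a one-dimensional channel (`A1g, A2g, B1g, B2g`). [cite: RaghuKivelsonScalapino2010, App. A (3d)] -/
theorem kform_lindhardSq_sub_eq_add_of_isChannelState {μ : ℝ} (hμ : μ < 0) {χ : D4Irrep} (hχ : χ ≠ D4Irrep.E)
    {ψ : Momentum → ℝ} (hψ : IsChannelState (squareDispersion 1 0) μ χ ψ) :
    kform (fermiCurveMeasure (squareDispersion 1 0) μ)
        (fun k k' => lindhardFunction (squareDispersion 1 0) μ (k - k') ^ 2) ψ =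
      kform (fermiCurveMeasure (squareDispersion 1 0) μ)
        (fun k k' => lindhardFunction (squareDispersion 1 0) μ (k + k') ^ 2) ψ :=
  kform_lindhardSq_sub_eq_add_of_even hμ ((isChannelState_parity hψ).1 hχ)

/-- **Even states, with integrability: the chain form is twice the crossed-ladder form**,
`⟨ψ, chainKernel3 ψ⟩ = 2 ⟨ψ, χ₀(k+k')² ψ⟩`, provided the inner integrals `∫ χ₀(k+k')² ψ(k') dσ(k')` converge for every
`k` (then so do the reflected ones). [cite: RaghuKivelsonScalapino2010, App. A (3d)] -/
theorem kform_chainKernel3_eq_two_mul_of_even {μ : ℝ} (hμ : μ < 0) {ψ : Momentum → ℝ}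
    (heven : ∀ k, ψ (-k) = ψ k)
    (hint : ∀ k : Momentum, Integrable (fun k' => lindhardFunction (squareDispersion 1 0) μ (k + k') ^ 2 * ψ k')
      (fermiCurveMeasure (squareDispersion 1 0) μ)) :
    kform (fermiCurveMeasure (squareDispersion 1 0) μ) (chainKernel3 (squareDispersion 1 0) μ) ψ =
      2 * kform (fermiCurveMeasure (squareDispersion 1 0) μ)
        (fun k k' => lindhardFunction (squareDispersion 1 0) μ (k + k') ^ 2) ψ := by
  unfold kform
  rw [← integral_const_mul]
  congr 1
  funext k
  have hneg : Integrable (fun k' => lindhardFunction (squareDispersion 1 0) μ (k - k') ^ 2 * ψ k')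
      (fermiCurveMeasure (squareDispersion 1 0) μ) := by
    have h := ((measurePreserving_neg_fermiCurveMeasure hμ).integrable_comp_emb
      (Homeomorph.neg Momentum).measurableEmbedding (g := fun k' =>
        lindhardFunction (squareDispersion 1 0) μ (k + k') ^ 2 * ψ k')).2 (hint k)
    refine h.congr (Filter.Eventually.of_forall fun k' => ?_)
    simp only [Function.comp_apply, heven, ← sub_eq_add_neg]
  have hsplit : ∫ k', chainKernel3 (squareDispersion 1 0) μ k k' * ψ k' ∂fermiCurveMeasure (squareDispersion 1 0) μ =
      (∫ k', lindhardFunction (squareDispersion 1 0) μ (k - k') ^ 2 * ψ k' ∂fermiCurveMeasure (squareDispersion 1 0) μ) +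
      ∫ k', lindhardFunction (squareDispersion 1 0) μ (k + k') ^ 2 * ψ k' ∂fermiCurveMeasure (squareDispersion 1 0) μ := by
    rw [← integral_add hneg (hint k)]
    congr 1
    funext k'
    simp only [chainKernel3]
    ring
  have hsub : ∫ k', lindhardFunction (squareDispersion 1 0) μ (k - k') ^ 2 * ψ k' ∂fermiCurveMeasure (squareDispersion 1 0) μ =
      ∫ k', lindhardFunction (squareDispersion 1 0) μ (k + k') ^ 2 * ψ k' ∂fermiCurveMeasure (squareDispersion 1 0) μ := by
    rw [← integral_comp_neg_fermiCurveMeasure hμ (fun k' => lindhardFunction (squareDispersion 1 0) μ (k - k') ^ 2 * ψ k')]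
    congr 1
    funext k'
    simp only [heven, sub_neg_eq_add]
  rw [hsplit, hsub]
  ring

end KlThirdOrder

end Summit.HubbardSuperconductivity.HubbardSuperconductivity.Theorems

end
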